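import Mathlib
import HarnessLib
import Summits.Ventures.LatticeQCDFlow.Exactness.IMHCommonRandomNumbersMeetingTimeLaw
import Summits.Ventures.LatticeQCDFlow.Scaling.AutoregressiveGaugeAllClosingColdExact

/-!
# LatticeQCDFlow / Scaling — the law of the disagreement time of two runs of the exact all-closing conditioner (`A = Z/∏_ℓ c_{#C_ℓ}`) on one stream of random numbers: geometric tail `P(T_M ≥ t) ≤ (1 − A)^{t−1}·P(U_0 ≠ U′_0)` and second moment `≤ P(U_0 ≠ U′_0)(1/A)(2/A − 1)` (Hausdorff `G`)

HONEST FRAMING: exact (Metropolis-corrected) sampling algorithms for lattice gauge theory;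
figures of merit are autocorrelation/cost numbers at stated couplings and volumes; no
continuum-physics claim.

Venture `LatticeQCDFlow` (cell pub-lqcd), topic `Scaling`, FANOUT row 30 (lean-1, GEN-38) — OUR WORK, the gauge instance of this
generation's abstract `Exactness/IMHCommonRandomNumbersMeetingTimeLaw` for the exact all-closing conditioner (`A = Z/∏_ℓ c_{#C_ℓ}`).  Setting as in
`Scaling/AutoregressiveGauge…CommonRandomNumbers` (GEN-36): the CRN pair kernel `K̂` feeds the SAME proposals and uniforms to two runs;
`A` is the sampler's acceptance at the cold configuration (displayed), `1/A` its cold weight.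
Two runs on ONE stream of proposals and uniforms (CRN pair kernel `K̂`), from EVERY initial coupling `μ̂₀`; `T_M = #{n < M : U_n ≠ U′_n}` the number
of shared updates (among the first `M`) during which they still disagree — the random overhead of the coupled estimators:

* **`allClosing_crn_disagreementCount_tail_le`** — `P(T_M ≥ t) ≤ (1 − A)^{t−1}·P(U_0 ≠ U′_0)` for every `t ≥ 1` and every `M`: a GEOMETRIC tail (the hypothesis
  of the printed unbiased-estimator literature is a theorem for the exact sampler), where GEN-37 had Markov's `P(U_0 ≠ U′_0)/(A t)`;
* **`allClosing_crn_disagreementCount_sq_le`** — `E[T_M²] ≤ P(U_0 ≠ U′_0)·(1/A)(2/A − 1)` uniformly in `M`; with `E[T_M] ≤ P(U_0 ≠ U′_0)/A` (GEN-37) the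
  overhead's variance is bounded.

NOT CLAIMED: the exact law of `T_M`; exponential moments; any value of `A`.  No `def`, no `sorry`, nothing cited as a fact.
-/

noncomputable section

namespace Summit.Ventures.LatticeQCDFlow.Theory2.Autoregressive

open MeasureTheory ProbabilityTheory Function Finset
open scoped ENNReal unitInterval
open Literature.MathematicalPhysics.QuantumFieldTheory Literature.MathematicalPhysics.QuantumLattice
open Summit.Ventures.LatticeQCDFlow.Exactness Summit.Ventures.LatticeQCDFlow.Scoring

variable {d L : ℕ} [NeZero L] {G : Type*} [Group G] [TopologicalSpace G] [IsTopologicalGroup G]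
  [CompactSpace G] [SecondCountableTopology G] [MeasurableSpace G] [BorelSpace G]

/-- **GEOMETRIC TAIL**: `P(T_M ≥ s) ≤ (1 − A)^{s−1}·P(U_0 ≠ U′_0)` for natural `s ≥ 1` (the exact all-closing conditioner (`A = Z/∏_ℓ c_{#C_ℓ}`); Hausdorff `G`). [ours] -/
theorem allClosing_crn_disagreementCount_tail_le [T2Space G] [MeasurableSingletonClass G] (hL : 2 ≤ L) {w : G → ℝ} (hw : Continuous w) {m M : ℝ} (hm0 : 0 < m)
    (hm : ∀ g, m ≤ w g) (hM : ∀ g, w g ≤ M) (hwinv : ∀ g, w g⁻¹ = w g)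
    (T : Finset (Edge d L)) (C : Edge d L → Finset (Plaquette d L))
    (hCne : ∀ ℓ ∈ T, (C ℓ).Nonempty)
    (hCe : ∀ ℓ ∈ T, ∀ p ∈ C ℓ, ℓ ∈ ({(p.1, p.2.1.1), (p.1.shift p.2.1.1, p.2.1.2),
        (p.1.shift p.2.1.2, p.2.1.1), (p.1, p.2.1.2)} : Finset (Edge d L)))
    (hdisj : ∀ ℓ ∈ T, ∀ ℓ' ∈ T, ℓ ≠ ℓ' → Disjoint (C ℓ) (C ℓ'))
    (hcover : ∀ p : Plaquette d L, ∃ ℓ ∈ T, p ∈ C ℓ)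
    (π q : Measure (GaugeConfig d L G)) [IsProbabilityMeasure π] [IsProbabilityMeasure q]
    (hπ : π = (Measure.pi fun _ : Edge d L => haarProbability G).withDensity fun U =>
      ENNReal.ofReal ((∏ p : Plaquette d L, w (plaquetteHolonomy U p.1 p.2.1.1 p.2.1.2)) /
        ∫ V, ∏ p : Plaquette d L, w (plaquetteHolonomy V p.1 p.2.1.1 p.2.1.2) ∂(Measure.pi fun _ : Edge d L => haarProbability G)))
    (hq : q = (Measure.pi fun _ : Edge d L => haarProbability G).withDensity fun U =>
      ENNReal.ofReal (∏ ℓ ∈ T, (∏ p ∈ C ℓ, w (plaquetteHolonomy U p.1 p.2.1.1 p.2.1.2)) /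
          (∫ v, ∏ p ∈ C ℓ, w (plaquetteHolonomy (update U ℓ v) p.1 p.2.1.1 p.2.1.2) ∂(haarProbability G))))
    [Fact (Measurable (fun U =>
        (((∫ V, ∏ p : Plaquette d L, w (plaquetteHolonomy V p.1 p.2.1.1 p.2.1.2) ∂(Measure.pi fun _ : Edge d L => haarProbability G)) /
          ∏ ℓ ∈ T, (∫ v, ∏ p ∈ C ℓ, w (plaquetteHolonomy (update U ℓ v) p.1 p.2.1.1 p.2.1.2) ∂(haarProbability G))))⁻¹))]
    (Khat : Kernel (GaugeConfig d L G × GaugeConfig d L G) (GaugeConfig d L G × GaugeConfig d L G))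
    [IsMarkovKernel Khat]
    (hK : ∀ z : GaugeConfig d L G × GaugeConfig d L G, Khat z =
      (q.prod (volume : Measure unitInterval)).map (fun p : GaugeConfig d L G × unitInterval =>
        ((if (p.2 : ℝ) * (fun U =>
        (((∫ V, ∏ p : Plaquette d L, w (plaquetteHolonomy V p.1 p.2.1.1 p.2.1.2) ∂(Measure.pi fun _ : Edge d L => haarProbability G)) /
          ∏ ℓ ∈ T, (∫ v, ∏ p ∈ C ℓ, w (plaquetteHolonomy (update U ℓ v) p.1 p.2.1.1 p.2.1.2) ∂(haarProbability G))))⁻¹) z.1 ≤ (fun U =>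
        (((∫ V, ∏ p : Plaquette d L, w (plaquetteHolonomy V p.1 p.2.1.1 p.2.1.2) ∂(Measure.pi fun _ : Edge d L => haarProbability G)) /
          ∏ ℓ ∈ T, (∫ v, ∏ p ∈ C ℓ, w (plaquetteHolonomy (update U ℓ v) p.1 p.2.1.1 p.2.1.2) ∂(haarProbability G))))⁻¹) p.1 then p.1 else z.1),
          (if (p.2 : ℝ) * (fun U =>
        (((∫ V, ∏ p : Plaquette d L, w (plaquetteHolonomy V p.1 p.2.1.1 p.2.1.2) ∂(Measure.pi fun _ : Edge d L => haarProbability G)) /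
          ∏ ℓ ∈ T, (∫ v, ∏ p ∈ C ℓ, w (plaquetteHolonomy (update U ℓ v) p.1 p.2.1.1 p.2.1.2) ∂(haarProbability G))))⁻¹) z.2 ≤ (fun U =>
        (((∫ V, ∏ p : Plaquette d L, w (plaquetteHolonomy V p.1 p.2.1.1 p.2.1.2) ∂(Measure.pi fun _ : Edge d L => haarProbability G)) /
          ∏ ℓ ∈ T, (∫ v, ∏ p ∈ C ℓ, w (plaquetteHolonomy (update U ℓ v) p.1 p.2.1.1 p.2.1.2) ∂(haarProbability G))))⁻¹) p.1 then p.1 else z.2))))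
(μ₀ : Measure (GaugeConfig d L G × GaugeConfig d L G)) [IsProbabilityMeasure μ₀] (Mn : ℕ) {s : ℕ} (hs : 1 ≤ s) :
    (Kernel.trajMeasure (X := fun _ : ℕ => GaugeConfig d L G × GaugeConfig d L G) μ₀
          (fun n : ℕ => Khat.comap (fun h : (i : ↥(Finset.Iic n)) → GaugeConfig d L G × GaugeConfig d L G => h ⟨n, Finset.mem_Iic.2 le_rfl⟩)
            (measurable_pi_apply _))).real
        {z | (s : ℝ) ≤ ∑ n ∈ Finset.range Mn, ((Set.diagonal (GaugeConfig d L G))ᶜ).indicator (1 : GaugeConfig d L G × GaugeConfig d L G → ℝ) (z n)} ≤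
      (1 - (((∫ V, ∏ p : Plaquette d L, w (plaquetteHolonomy V p.1 p.2.1.1 p.2.1.2) ∂(Measure.pi fun _ : Edge d L => haarProbability G)) /
        ∏ ℓ ∈ T, ∫ h, w h ^ (C ℓ).card ∂(haarProbability G)))) ^ (s - 1) * μ₀.real (Set.diagonal (GaugeConfig d L G))ᶜ := by
  obtain ⟨hA, hρq, hmax, hρm, hρpos⟩ := allClosing_cold_acceptMass_eq hL hw hm0 hm hM hwinv T C hCne hCe hdisj hcover π q hπ hq
  set cold : GaugeConfig d L G := fun _ => (1 : G) with hcold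
  set ρ : GaugeConfig d L G → ℝ := fun U =>
    ((∫ V, ∏ p : Plaquette d L, w (plaquetteHolonomy V p.1 p.2.1.1 p.2.1.2) ∂(Measure.pi fun _ : Edge d L => haarProbability G)) /
      ∏ ℓ ∈ T, (∫ v, ∏ p ∈ C ℓ, w (plaquetteHolonomy (update U ℓ v) p.1 p.2.1.1 p.2.1.2) ∂(haarProbability G))) with hρ
  have hw0' : ∀ U, 0 < (ρ U)⁻¹ := fun U => inv_pos.2 (hρpos U)
  have hπ' : (q.withDensity fun U => ENNReal.ofReal (ρ U)⁻¹) = π := withDensity_inv_density hρm hρpos hρq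
  haveI : IsProbabilityMeasure (q.withDensity fun U => ENNReal.ofReal (ρ U)⁻¹) := by rw [hπ']; infer_instance
  have hone : ∫⁻ y, ENNReal.ofReal (ρ y)⁻¹ ∂q = ENNReal.ofReal 1 := by
    have h : π Set.univ = 1 := measure_univ
    rw [← hπ', withDensity_apply _ MeasurableSet.univ, Measure.restrict_univ] at h
    rw [h, ENNReal.ofReal_one]
  have hA' := imhAcceptMass_toReal_eq_of_forall_le (q := q) hw0' cold hmax zero_le_one hone
  have hrate : ((ρ cold)⁻¹)⁻¹ = ((∫ V, ∏ p : Plaquette d L, w (plaquetteHolonomy V p.1 p.2.1.1 p.2.1.2) ∂(Measure.pi fun _ : Edge d L => haarProbability G)) /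
        ∏ ℓ ∈ T, ∫ h, w h ^ (C ℓ).card ∂(haarProbability G)) := by
    rw [← hA, hA', one_div]
  have hwm : Measurable fun U => (ρ U)⁻¹ := hρm.inv
  have h := crn_chain_disagreementCount_tail_le (q := q) hwm hw0' hmax Khat hK μ₀ Mn hs (x₀ := cold)
  rw [hrate] at h
  exact h

/-- **SECOND MOMENT**: `E[T_M²] ≤ P(U_0 ≠ U′_0)·(1/A)(2/A − 1)` on the pair path law, every `M`, every initial coupling (the exact all-closing conditioner (`A = Z/∏_ℓ c_{#C_ℓ}`); Hausdorff `G`). [ours] -/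
theorem allClosing_crn_disagreementCount_sq_le [T2Space G] [MeasurableSingletonClass G] (hL : 2 ≤ L) {w : G → ℝ} (hw : Continuous w) {m M : ℝ} (hm0 : 0 < m)
    (hm : ∀ g, m ≤ w g) (hM : ∀ g, w g ≤ M) (hwinv : ∀ g, w g⁻¹ = w g)
    (T : Finset (Edge d L)) (C : Edge d L → Finset (Plaquette d L))
    (hCne : ∀ ℓ ∈ T, (C ℓ).Nonempty)
    (hCe : ∀ ℓ ∈ T, ∀ p ∈ C ℓ, ℓ ∈ ({(p.1, p.2.1.1), (p.1.shift p.2.1.1, p.2.1.2),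
        (p.1.shift p.2.1.2, p.2.1.1), (p.1, p.2.1.2)} : Finset (Edge d L)))
    (hdisj : ∀ ℓ ∈ T, ∀ ℓ' ∈ T, ℓ ≠ ℓ' → Disjoint (C ℓ) (C ℓ'))
    (hcover : ∀ p : Plaquette d L, ∃ ℓ ∈ T, p ∈ C ℓ)
    (π q : Measure (GaugeConfig d L G)) [IsProbabilityMeasure π] [IsProbabilityMeasure q]
    (hπ : π = (Measure.pi fun _ : Edge d L => haarProbability G).withDensity fun U =>
      ENNReal.ofReal ((∏ p : Plaquette d L, w (plaquetteHolonomy U p.1 p.2.1.1 p.2.1.2)) /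
        ∫ V, ∏ p : Plaquette d L, w (plaquetteHolonomy V p.1 p.2.1.1 p.2.1.2) ∂(Measure.pi fun _ : Edge d L => haarProbability G)))
    (hq : q = (Measure.pi fun _ : Edge d L => haarProbability G).withDensity fun U =>
      ENNReal.ofReal (∏ ℓ ∈ T, (∏ p ∈ C ℓ, w (plaquetteHolonomy U p.1 p.2.1.1 p.2.1.2)) /
          (∫ v, ∏ p ∈ C ℓ, w (plaquetteHolonomy (update U ℓ v) p.1 p.2.1.1 p.2.1.2) ∂(haarProbability G))))
    [Fact (Measurable (fun U =>
        (((∫ V, ∏ p : Plaquette d L, w (plaquetteHolonomy V p.1 p.2.1.1 p.2.1.2) ∂(Measure.pi fun _ : Edge d L => haarProbability G)) /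
          ∏ ℓ ∈ T, (∫ v, ∏ p ∈ C ℓ, w (plaquetteHolonomy (update U ℓ v) p.1 p.2.1.1 p.2.1.2) ∂(haarProbability G))))⁻¹))]
    (Khat : Kernel (GaugeConfig d L G × GaugeConfig d L G) (GaugeConfig d L G × GaugeConfig d L G))
    [IsMarkovKernel Khat]
    (hK : ∀ z : GaugeConfig d L G × GaugeConfig d L G, Khat z =
      (q.prod (volume : Measure unitInterval)).map (fun p : GaugeConfig d L G × unitInterval =>
        ((if (p.2 : ℝ) * (fun U =>
        (((∫ V, ∏ p : Plaquette d L, w (plaquetteHolonomy V p.1 p.2.1.1 p.2.1.2) ∂(Measure.pi fun _ : Edge d L => haarProbability G)) /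
          ∏ ℓ ∈ T, (∫ v, ∏ p ∈ C ℓ, w (plaquetteHolonomy (update U ℓ v) p.1 p.2.1.1 p.2.1.2) ∂(haarProbability G))))⁻¹) z.1 ≤ (fun U =>
        (((∫ V, ∏ p : Plaquette d L, w (plaquetteHolonomy V p.1 p.2.1.1 p.2.1.2) ∂(Measure.pi fun _ : Edge d L => haarProbability G)) /
          ∏ ℓ ∈ T, (∫ v, ∏ p ∈ C ℓ, w (plaquetteHolonomy (update U ℓ v) p.1 p.2.1.1 p.2.1.2) ∂(haarProbability G))))⁻¹) p.1 then p.1 else z.1),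
          (if (p.2 : ℝ) * (fun U =>
        (((∫ V, ∏ p : Plaquette d L, w (plaquetteHolonomy V p.1 p.2.1.1 p.2.1.2) ∂(Measure.pi fun _ : Edge d L => haarProbability G)) /
          ∏ ℓ ∈ T, (∫ v, ∏ p ∈ C ℓ, w (plaquetteHolonomy (update U ℓ v) p.1 p.2.1.1 p.2.1.2) ∂(haarProbability G))))⁻¹) z.2 ≤ (fun U =>
        (((∫ V, ∏ p : Plaquette d L, w (plaquetteHolonomy V p.1 p.2.1.1 p.2.1.2) ∂(Measure.pi fun _ : Edge d L => haarProbability G)) /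
          ∏ ℓ ∈ T, (∫ v, ∏ p ∈ C ℓ, w (plaquetteHolonomy (update U ℓ v) p.1 p.2.1.1 p.2.1.2) ∂(haarProbability G))))⁻¹) p.1 then p.1 else z.2))))
(μ₀ : Measure (GaugeConfig d L G × GaugeConfig d L G)) [IsProbabilityMeasure μ₀] (Mn : ℕ) :
    ∫ z, (∑ n ∈ Finset.range Mn, ((Set.diagonal (GaugeConfig d L G))ᶜ).indicator (1 : GaugeConfig d L G × GaugeConfig d L G → ℝ) (z n)) ^ 2
        ∂(Kernel.trajMeasure (X := fun _ : ℕ => GaugeConfig d L G × GaugeConfig d L G) μ₀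
          (fun n : ℕ => Khat.comap (fun h : (i : ↥(Finset.Iic n)) → GaugeConfig d L G × GaugeConfig d L G => h ⟨n, Finset.mem_Iic.2 le_rfl⟩)
            (measurable_pi_apply _))) ≤ μ₀.real (Set.diagonal (GaugeConfig d L G))ᶜ * ((((∫ V, ∏ p : Plaquette d L, w (plaquetteHolonomy V p.1 p.2.1.1 p.2.1.2) ∂(Measure.pi fun _ : Edge d L => haarProbability G)) /
        ∏ ℓ ∈ T, ∫ h, w h ^ (C ℓ).card ∂(haarProbability G)))⁻¹ * (2 * (((∫ V, ∏ p : Plaquette d L, w (plaquetteHolonomy V p.1 p.2.1.1 p.2.1.2) ∂(Measure.pi fun _ : Edge d L => haarProbability G)) /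
        ∏ ℓ ∈ T, ∫ h, w h ^ (C ℓ).card ∂(haarProbability G)))⁻¹ - 1)) := by
  obtain ⟨hA, hρq, hmax, hρm, hρpos⟩ := allClosing_cold_acceptMass_eq hL hw hm0 hm hM hwinv T C hCne hCe hdisj hcover π q hπ hq
  set cold : GaugeConfig d L G := fun _ => (1 : G) with hcold
  set ρ : GaugeConfig d L G → ℝ := fun U =>
    ((∫ V, ∏ p : Plaquette d L, w (plaquetteHolonomy V p.1 p.2.1.1 p.2.1.2) ∂(Measure.pi fun _ : Edge d L => haarProbability G)) /
      ∏ ℓ ∈ T, (∫ v, ∏ p ∈ C ℓ, w (plaquetteHolonomy (update U ℓ v) p.1 p.2.1.1 p.2.1.2) ∂(haarProbability G))) with hρ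
  have hw0' : ∀ U, 0 < (ρ U)⁻¹ := fun U => inv_pos.2 (hρpos U)
  have hπ' : (q.withDensity fun U => ENNReal.ofReal (ρ U)⁻¹) = π := withDensity_inv_density hρm hρpos hρq
  haveI : IsProbabilityMeasure (q.withDensity fun U => ENNReal.ofReal (ρ U)⁻¹) := by rw [hπ']; infer_instance
  have hone : ∫⁻ y, ENNReal.ofReal (ρ y)⁻¹ ∂q = ENNReal.ofReal 1 := by
    have h : π Set.univ = 1 := measure_univ
    rw [← hπ', withDensity_apply _ MeasurableSet.univ, Measure.restrict_univ] at h
    rw [h, ENNReal.ofReal_one]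
  have hA' := imhAcceptMass_toReal_eq_of_forall_le (q := q) hw0' cold hmax zero_le_one hone
  have hrate : ((ρ cold)⁻¹)⁻¹ = ((∫ V, ∏ p : Plaquette d L, w (plaquetteHolonomy V p.1 p.2.1.1 p.2.1.2) ∂(Measure.pi fun _ : Edge d L => haarProbability G)) /
        ∏ ℓ ∈ T, ∫ h, w h ^ (C ℓ).card ∂(haarProbability G)) := by
    rw [← hA, hA', one_div]
  have h := crn_chain_integral_disagreementCount_sq_le (q := q) hw0' hmax Khat hK μ₀ Mn (x₀ := cold)
  rw [show (ρ cold)⁻¹ = (((∫ V, ∏ p : Plaquette d L, w (plaquetteHolonomy V p.1 p.2.1.1 p.2.1.2) ∂(Measure.pi fun _ : Edge d L => haarProbability G)) /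
        ∏ ℓ ∈ T, ∫ h, w h ^ (C ℓ).card ∂(haarProbability G)))⁻¹ from by rw [← hrate, inv_inv]] at h
  exact h

end Summit.Ventures.LatticeQCDFlow.Theory2.Autoregressive

end
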